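import Literature.Barriers.ValiantsHypothesis.CT23EquationsForSmallCircuits
import Literature.Computability.AlgebraicComplexity.DetInVP
import Literature.Computability.AlgebraicComplexity.DeterminantalComplexityProofs
import Literature.Computability.AlgebraicComplexity.DeterminantalConormalBoundKernelAlgebra
import Summits.ValiantsHypothesis.ValiantsHypothesis.Theorems.BarrierLeverDefinableEquationsVNPVersusVPSPACEEngine

/-!
# Crux `DefinableDcEquations` (stmt-ValiantsHypothesis-8746) of route BarrierLever —
# UNCONDITIONAL `VPSPACE⁰`-explicit equations for its slice: Chatterjee–Tengse Lemma 4.7 on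
# `{deg f ≤ n, dc f ≤ 2^((log₂ n + 1)³)}` (route-independent helper file, val-np-p5 g24)

The rank-4 crux asks, for SOME super-quasi-quadratic threshold `m` (`2^(C (log₂ n+1)²) ≤ m(n)`
eventually for every `C`), for `VNP(N)`-explicit equations (nonzero level-`a` Boolean sums,
`N = C(2n,n)`) vanishing on the coefficient vectors of `{f : deg f ≤ n, dc f ≤ m(n)}`.  What holds
UNCONDITIONALLY one class higher: since `CT23_lemma_4_7_holds` (val-lit; Chatterjee–Tengse,
arXiv:2309.07612, Lemma 4.7) the EVALUATION vectors of `{deg ≤ n, L(f) ≤ s}` have nonzero multilinear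
integer equations computed by constant-free fan-in-two PROJECTION circuits of size `(n·n·s)^c`
whenever `(n·n·s)^c ≤ C(2n,n)`.  This file instantiates it for the crux's slice at the admissible
threshold `m(n) = 2^((log₂ n + 1)³)`:

* (`m` satisfies the growth clause of `DefinableDcEquations`: the tree's
  `BalancedStrength.threshold_admissible`, val-np-p5 g21;)
* `complexity_le_of_dc_le` — `dc f ≤ m ⇒ L(f) ≤ 8(m+1)^7 + m²(2n+1)` (Berkowitz, tree
  `complexity_detPoly_le`, plus the affine substitution; re-derived here route-independently —
  the tree's `complexity_le_of_determinantalComplexity` sits under route DetQP);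
* `dc_regime` — the regime arithmetic `(n·n·s)^c ≤ 2^(20 c (log₂ n+1)³) ≤ 2^n` for
  `n ≥ 2^(max 256 (160 c))` (`pow_le_two_pow_of_le`: `L^4 ≤ 2^L` for `L ≥ 256`);
* **`dcSlice_evalEquations`** — for all large `n`, a nonzero MULTILINEAR integer polynomial in
  the `C(2n,n)` evaluation coordinates `x^{≤ n}`, computed (as `rename Sum.inl P`, with `t` bound
  workspace variables) by a fan-in-two constant-free circuit with projection gates with `t` and
  size `≤ 2^(c (log₂ n + 1)³)` — QUASI-POLYNOMIAL in `n`, i.e. `N^{o(1)}` — and `≤ 2^n`, vanishing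
  at the evaluation vector of every `f` with `deg f ≤ n`, `dc f ≤ 2^((log₂ n + 1)³)`.  The 8746
  analogue of the Literature's `smallCircuits_evalEquations` (which serves 8745/8749); consumed by
  `…BarrierLeverDefinableEquationsVNPVersusVPSPACE.lean` (refuting 8746 separates `VNP_ℂ` from
  `VPSPACE⁰_b`).

HONEST READING: these are `VPSPACE⁰`-explicit (projection-gate) equations for the evaluation
vectors, NOT the `VNP(N)`-explicit Boolean-sum equations the crux asks for (Chatterjee–Tengse
Remark 1.5: incomparable a priori; §1.3 direction 2 open); the crux stays OPEN; `VP ≠ VNP` is NOT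
proved and nothing here bears on it.  No definitions, no named facts, standard axioms.

## References

* [ChatterjeeTengse2023] P. Chatterjee, A. Tengse, *Lower Bounds from Succinct Hitting Sets*,
  arXiv:2309.07612, Lemma 4.7 (v1 Lemma 50) and Remark 1.5.
* [MignonRessayre2004] T. Mignon, N. Ressayre, *A quadratic bound for the determinant and
  permanent problem*, IMRN 2004 (determinantal complexity, the tree's `determinantalComplexity`).
-/

-- `Summit.ValiantsHypothesis.ValiantsHypothesis.…` repeats a component by the D-0017 layout
-- (single-conjunct summit), which the `dupNamespace` linter flags; the name is mandated.
set_option linter.dupNamespace false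

noncomputable section

namespace Summit.ValiantsHypothesis.ValiantsHypothesis.Theorems.BarrierLeverDefinableEquations

open MvPolynomial
open Literature.Computability.AlgebraicComplexity Literature.Barriers.ValiantsHypothesis
open scoped BigOperators

namespace VNPVersusVPSPACE

/-! ## §1 Arithmetic: polynomial versus exponential and the regime -/

/-- `n^k ≤ 2^n` once `2^{2k} ≤ n`. [folklore] -/
theorem pow_le_two_pow_of_le {k n : ℕ} (h : 2 ^ (2 * k) ≤ n) : n ^ k ≤ 2 ^ n := by
  -- adapted from the private helper of Literature/…/CT23SuccinctHittingSetsVersusVPSPACE.lean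
  rcases Nat.eq_zero_or_pos k with rfl | hk
  · simp [Nat.one_le_two_pow]
  have hn : 0 < n := lt_of_lt_of_le (by positivity) h
  set m := Nat.log 2 n with hm
  have h2m : 2 ^ m ≤ n := Nat.pow_log_le_self 2 hn.ne'
  have hnlt : n < 2 ^ (m + 1) := Nat.lt_pow_succ_log_self (by norm_num) n
  have h2k : 2 * k ≤ m := by
    have : 2 ^ (2 * k) < 2 ^ (m + 1) := lt_of_le_of_lt h hnlt
    have := (Nat.pow_lt_pow_iff_right (by norm_num : 1 < 2)).1 this
    omega
  have hkm : k * (m + 1) ≤ 2 ^ m := by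
    have h1 : 2 * (k * (m + 1)) ≤ m * (m + 1) := by nlinarith
    have key : ∀ j : ℕ, j * (j + 1) ≤ 2 * 2 ^ j := by
      intro j
      induction j with
      | zero => simp
      | succ j ih =>
        have h2 : 2 ^ (j + 1) = 2 * 2 ^ j := by ring
        have hj : j < 2 ^ j := Nat.lt_two_pow_self
        nlinarith [hj, ih]
    have := key m
    omega
  calc n ^ k ≤ (2 ^ (m + 1)) ^ k := Nat.pow_le_pow_left hnlt.le k
    _ = 2 ^ (k * (m + 1)) := by rw [← pow_mul, mul_comm]
    _ ≤ 2 ^ (2 ^ m) := Nat.pow_le_pow_right (by norm_num) hkm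
    _ ≤ 2 ^ n := Nat.pow_le_pow_right (by norm_num) h2m

/-- **Regime arithmetic for the quasi-polynomial slice.**  With `L = log₂ n`, `m = 2^((L+1)³)` and
`s = 8(m+1)^7 + m²(2n+1)`: `(n·n·s)^c ≤ 2^(20 c (L+1)³) ≤ 2^n` as soon as `n ≥ 2^(max 256 (160 c))`.
[folklore] -/
theorem dc_regime {c n m s : ℕ} (hm : m = 2 ^ ((Nat.log 2 n + 1) ^ 3))
    (hs : s = 8 * (m + 1) ^ 7 + m ^ 2 * (2 * n + 1)) (hn : 2 ^ max 256 (160 * c) ≤ n) :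
    (n * n * s) ^ c ≤ 2 ^ (20 * c * (Nat.log 2 n + 1) ^ 3) ∧
      2 ^ (20 * c * (Nat.log 2 n + 1) ^ 3) ≤ 2 ^ n := by
  have hn0 : n ≠ 0 := by
    have : 0 < 2 ^ max 256 (160 * c) := by positivity
    omega
  set L := Nat.log 2 n with hLdef
  have hL : max 256 (160 * c) ≤ L := Nat.le_log_of_pow_le (by norm_num) hn
  have h2L : 2 ^ L ≤ n := Nat.pow_log_le_self 2 hn0
  have hnlt : n < 2 ^ (L + 1) := Nat.lt_pow_succ_log_self (by norm_num) n
  set K := (L + 1) ^ 3 with hKdef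
  have hK1 : L + 1 ≤ K := Nat.le_self_pow (by norm_num) (L + 1)
  have hK0 : 1 ≤ K := le_trans (by omega) hK1
  -- `n ≤ 2^K`, `m + 1 ≤ 2^(K+1)`, `2n + 1 ≤ 2^(K+1)`
  have hnK : n ≤ 2 ^ K := hnlt.le.trans (Nat.pow_le_pow_right (by norm_num) hK1)
  have hm1 : 1 ≤ m := by rw [hm]; exact Nat.one_le_two_pow
  have hmK : m + 1 ≤ 2 ^ (K + 1) := by rw [pow_succ, hm]; omega
  have h2n : 2 * n + 1 ≤ 2 ^ (K + 1) := by
    have h1 : 2 ^ (L + 2) ≤ 2 ^ (K + 1) := Nat.pow_le_pow_right (by norm_num) (by omega)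
    have h2 : 2 ^ (L + 2) = 2 * 2 ^ (L + 1) := by ring
    omega
  -- `s ≤ 2^(7K+11)`
  have hs1 : 8 * (m + 1) ^ 7 ≤ 2 ^ (7 * K + 10) := by
    calc 8 * (m + 1) ^ 7 ≤ 8 * (2 ^ (K + 1)) ^ 7 := Nat.mul_le_mul_left _ (Nat.pow_le_pow_left hmK 7)
      _ = 2 ^ (7 * K + 10) := by rw [← pow_mul, show (8 : ℕ) = 2 ^ 3 by norm_num, ← pow_add]; ring_nf
  have hs2 : m ^ 2 * (2 * n + 1) ≤ 2 ^ (3 * K + 1) := by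
    calc m ^ 2 * (2 * n + 1) ≤ (2 ^ K) ^ 2 * 2 ^ (K + 1) :=
          Nat.mul_le_mul (by rw [hm]) h2n
      _ = 2 ^ (3 * K + 1) := by rw [← pow_mul, ← pow_add]; ring_nf
  have hsK : s ≤ 2 ^ (7 * K + 11) := by
    have h3 : 2 ^ (3 * K + 1) ≤ 2 ^ (7 * K + 10) := Nat.pow_le_pow_right (by norm_num) (by omega)
    calc s = 8 * (m + 1) ^ 7 + m ^ 2 * (2 * n + 1) := hs
      _ ≤ 2 ^ (7 * K + 10) + 2 ^ (7 * K + 10) := Nat.add_le_add hs1 (hs2.trans h3)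
      _ = 2 ^ (7 * K + 11) := by ring
  -- `n n s ≤ 2^(20 K)`
  have hnns : n * n * s ≤ 2 ^ (20 * K) := by
    calc n * n * s ≤ 2 ^ K * 2 ^ K * 2 ^ (7 * K + 11) :=
          Nat.mul_le_mul (Nat.mul_le_mul hnK hnK) hsK
      _ = 2 ^ (9 * K + 11) := by rw [← pow_add, ← pow_add]; ring_nf
      _ ≤ 2 ^ (20 * K) := Nat.pow_le_pow_right (by norm_num) (by omega)
  -- the key growth inequality `20 c (L+1)^3 ≤ 2^L`
  have hkey : 20 * c * K ≤ 2 ^ L := by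
    have hL256 : 2 ^ (2 * 4) ≤ L := le_trans (by norm_num) (le_trans (le_max_left _ _) hL)
    have hLc : 160 * c ≤ L := le_trans (le_max_right _ _) hL
    have hK8 : K ≤ 8 * L ^ 3 := by
      calc K = (L + 1) ^ 3 := hKdef
        _ ≤ (2 * L) ^ 3 := Nat.pow_le_pow_left (by omega) 3
        _ = 8 * L ^ 3 := by ring
    have hL4 : L ^ 4 ≤ 2 ^ L := pow_le_two_pow_of_le hL256
    calc 20 * c * K ≤ 20 * c * (8 * L ^ 3) := Nat.mul_le_mul_left _ hK8
      _ = 160 * c * L ^ 3 := by ring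
      _ ≤ L * L ^ 3 := Nat.mul_le_mul_right _ hLc
      _ = L ^ 4 := by ring
      _ ≤ 2 ^ L := hL4
  constructor
  · calc (n * n * s) ^ c ≤ (2 ^ (20 * K)) ^ c := Nat.pow_le_pow_left hnns c
      _ = 2 ^ (20 * c * (Nat.log 2 n + 1) ^ 3) := by rw [← pow_mul, hKdef, hLdef]; ring_nf
  · calc 2 ^ (20 * c * (Nat.log 2 n + 1) ^ 3) = 2 ^ (20 * c * K) := by rw [hKdef, hLdef]
      _ ≤ 2 ^ (2 ^ L) := Nat.pow_le_pow_right (by norm_num) hkey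
      _ ≤ 2 ^ n := Nat.pow_le_pow_right (by norm_num) h2L

/-! ## §2 From determinantal complexity to circuit complexity (Berkowitz) -/

/-- An affine form in `n` variables costs at most `2n + 1` gates: `p = C p₀ + Σᵢ C pᵢ · Xᵢ`.
[folklore] -/
theorem complexity_le_of_totalDegree_le_one' {k : Type*} [CommRing k] {σ : Type*} [Fintype σ]
    {p : MvPolynomial σ k} (hp : p.totalDegree ≤ 1) :
    complexity p ≤ 2 * Fintype.card σ + 1 := by
  -- adapted from `…Theorems/DetqpThesis/Negative/IffPerNotVQP.lean` (route-independent copy)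
  classical
  rw [DeterminantalConormal.eq_C_add_sum_of_totalDegree_le_one hp]
  have hterm : ∀ i : σ, complexity (C (coeff (Finsupp.single i 1) p) * X i : MvPolynomial σ k) ≤ 1 :=
    fun i => (complexity_mul_le_holds _ _).trans (by rw [complexity_C_holds, complexity_X_holds])
  have hsum : complexity (∑ i, C (coeff (Finsupp.single i 1) p) * X i : MvPolynomial σ k) ≤
      Fintype.card σ + Fintype.card σ := by
    refine (complexity_finset_sum_le _ _).trans ?_
    rw [Finset.card_univ]
    refine Nat.add_le_add_right ?_ _
    calc ∑ i, complexity (C (coeff (Finsupp.single i 1) p) * X i : MvPolynomial σ k)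
        ≤ ∑ _i : σ, 1 := Finset.sum_le_sum fun i _ => hterm i
      _ = Fintype.card σ := by simp
  calc complexity (C (coeff 0 p) + ∑ i, C (coeff (Finsupp.single i 1) p) * X i)
      ≤ complexity (C (coeff 0 p) : MvPolynomial σ k) +
          complexity (∑ i, C (coeff (Finsupp.single i 1) p) * X i : MvPolynomial σ k) + 1 :=
        complexity_add_le_holds _ _
    _ ≤ 0 + (Fintype.card σ + Fintype.card σ) + 1 := by
        rw [complexity_C_holds]; exact Nat.add_le_add_right (Nat.add_le_add_left hsum _) _
    _ = 2 * Fintype.card σ + 1 := by ring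

/-- An affine determinantal representation of size `m` gives a circuit of size
`≤ 8(m+1)^7 + m²(2n+1)`: substitute the affine entries into Berkowitz's circuit for `DET_m`
(`complexity_detPoly_le`, `L(DET_m) ≤ 8(m+1)^7`). [cite: MignonRessayre2004, §1 (determinantal complexity)] -/
theorem complexity_le_of_isAffineDetRepr' {n m : ℕ} {f : MvPolynomial (Fin n) ℂ}
    {A : Matrix (Fin m) (Fin m) (MvPolynomial (Fin n) ℂ)} (hA : IsAffineDetRepr f A) :
    complexity f ≤ 8 * (m + 1) ^ 7 + m ^ 2 * (2 * n + 1) := by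
  -- adapted from `…Theorems/DetqpThesis/Negative/IffPerNotVQP.lean` (route-independent copy)
  obtain ⟨haff, hdet⟩ := hA
  have hf : f = aeval (fun p : Fin m × Fin m => A p.1 p.2) (detPoly (Fin m) ℂ) := by
    rw [← hdet, detPoly, AlgHom.map_det, Matrix.mvPolynomialX_mapMatrix_aeval]
  rw [hf]
  refine (complexity_aeval_le _ _).trans (Nat.add_le_add (complexity_detPoly_le ℂ m) ?_)
  calc ∑ p : Fin m × Fin m, complexity (A p.1 p.2)
      ≤ ∑ _p : Fin m × Fin m, (2 * Fintype.card (Fin n) + 1) :=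
        Finset.sum_le_sum fun p _ => complexity_le_of_totalDegree_le_one' (haff p.1 p.2)
    _ = m ^ 2 * (2 * n + 1) := by simp [sq]

/-- **`dc f ≤ m ⇒ L(f) ≤ 8(m+1)^7 + m²(2n+1)`** for `f` in `n` variables over `ℂ` (the infimum
`dc f` is attained, `hasDetRepr_determinantalComplexity_holds`). [cite: MignonRessayre2004, §1 (determinantal complexity)] -/
theorem complexity_le_of_dc_le {n m : ℕ} {f : MvPolynomial (Fin n) ℂ}
    (h : determinantalComplexity f ≤ m) :
    complexity f ≤ 8 * (m + 1) ^ 7 + m ^ 2 * (2 * n + 1) := by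
  obtain ⟨A, hA⟩ := hasDetRepr_determinantalComplexity_holds f
  refine (complexity_le_of_isAffineDetRepr' hA).trans ?_
  gcongr

/-! ## §3 Chatterjee–Tengse's projection-circuit equations for the slice of crux 8746 -/

/-- **Equations for the super-quasi-polynomial determinantal slice by constant-free projection
circuits of size `2^(O(log³ n))`, UNCONDITIONALLY** (Chatterjee–Tengse Lemma 4.7 — the tree's
theorem `CT23_lemma_4_7_holds` — at `d = n`, `s = 8(m+1)^7 + m²(2n+1)`, `m = 2^((log₂ n+1)³)`, its
regime `(n·n·s)^c ≤ C(2n,n)` discharged by `dc_regime`).  For all large `n` there is a nonzero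
MULTILINEAR integer polynomial `P` in the `C(2n,n)` evaluation coordinates `x^{≤ n}`, computed (as
`rename Sum.inl P`, with `t` bound workspace variables) by a fan-in-two constant-free circuit with
projection gates, `t` and the size both `≤ 2^(c (log₂ n + 1)³)` — quasi-polynomial in `n`, i.e.
`N^{o(1)}` with `N = C(2n,n)` — and `≤ 2^n`, vanishing at the evaluation vector `evalVector ℂ n f` of
every `f` with `deg f ≤ n` and `dc f ≤ 2^((log₂ n + 1)³)`.  HONEST READING: `VPSPACE⁰`-explicit, not
`VNP(N)`-explicit; the crux stays OPEN; nothing here bears on `VP ≠ VNP`.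
[cite: ChatterjeeTengse2023, Lemma 4.7 (v1: Lemma 50)] -/
theorem dcSlice_evalEquations :
    ∃ c n₀ : ℕ, ∀ n : ℕ, n₀ ≤ n →
      ∃ (t : ℕ) (P : MvPolynomial (monomialsDegLE n n) ℤ)
        (Q : ProjCircuit ℤ (monomialsDegLE n n ⊕ Fin t)),
        P ≠ 0 ∧ (∀ v, P.degreeOf v ≤ 1) ∧ Q.IsFanInTwo ∧ Q.HasSignConstants ∧
          Q.Computes (rename Sum.inl P) ∧
          t ≤ 2 ^ (c * (Nat.log 2 n + 1) ^ 3) ∧ Q.size ≤ 2 ^ (c * (Nat.log 2 n + 1) ^ 3) ∧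
          t ≤ 2 ^ n ∧ Q.size ≤ 2 ^ n ∧
            ∀ f : MvPolynomial (Fin n) ℂ, f.totalDegree ≤ n →
              determinantalComplexity f ≤ 2 ^ ((Nat.log 2 n + 1) ^ 3) →
              eval (evalVector ℂ n f) (MvPolynomial.map (Int.castRingHom ℂ) P) = 0 := by
  obtain ⟨c₀, N₀, h⟩ := CT23_lemma_4_7_holds ℂ
  refine ⟨20 * c₀, max N₀ (2 ^ max 256 (160 * c₀)), fun n hn => ?_⟩
  have hN₀ : N₀ ≤ n := le_trans (le_max_left _ _) hn
  have hbig : 2 ^ max 256 (160 * c₀) ≤ n := le_trans (le_max_right _ _) hn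
  set m : ℕ := 2 ^ ((Nat.log 2 n + 1) ^ 3) with hmdef
  set s : ℕ := 8 * (m + 1) ^ 7 + m ^ 2 * (2 * n + 1) with hsdef
  obtain ⟨hreg, h2n⟩ := dc_regime (c := c₀) hmdef hsdef hbig
  have hm1 : 1 ≤ m := Nat.one_le_two_pow
  have hns : n ≤ s := by
    have : 2 * n + 1 ≤ m ^ 2 * (2 * n + 1) := Nat.le_mul_of_pos_left _ (by positivity)
    omega
  have hsN : N₀ ≤ s := hN₀.trans hns
  have hchoose : (n * n * s) ^ c₀ ≤ (n + n).choose n := by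
    rw [← two_mul]
    exact (hreg.trans h2n).trans (Literature.ModelTheory.FiniteModelTheory.two_pow_le_choose_two_mul_self n)
  obtain ⟨t, P, Q, hP0, hml, hfi, hsc, hcomp, ht, hsize, hvan⟩ := h n n s hN₀ hN₀ hsN hchoose
  refine ⟨t, P, Q, hP0, hml, hfi, hsc, hcomp, ht.trans hreg, hsize.trans hreg,
    ht.trans (hreg.trans h2n), hsize.trans (hreg.trans h2n), fun f hdeg hdc => ?_⟩
  exact hvan f hdeg (complexity_le_of_dc_le hdc)

end VNPVersusVPSPACE

end Summit.ValiantsHypothesis.ValiantsHypothesis.Theorems.BarrierLeverDefinableEquations
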